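import Literature.NumberTheory.GaloisRepresentations.LocalGaloisGroupProofs
import Mathlib.RingTheory.Filtration
import HarnessLib

/-!
# Discharge of `absInertia_map_absGaloisRestrict_le` (trunk GalRep, item C4): `res (I_E) ≤ I_F`

This sibling file of `Literature.NumberTheory.GaloisRepresentations.LocalGaloisGroup` proves the
last named fact of that file that was still open,

* `Literature.NumberTheory.GaloisRepresentations.absInertia_map_absGaloisRestrict_le_holds :
    absInertia_map_absGaloisRestrict_le F E`,

i.e. for non-archimedean local fields `F`, `E` and an `F`-algebra structure on `E`, the restriction
`res = absGaloisRestrict F E : Gal(Ē/E) → Gal(F̄/F)` maps the inertia group `I_E` into `I_F`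
(Serre, *Local Fields*, Ch. I §7, Prop. 22 a): `T(L/E) = T(L/K) ∩ G(L/E)`; Tate, *Number theoretic
background*, §1.4, (1.4.5)–(1.4.6): `W_E = G_E ∩ W_F`).

## The statement as registered

The `def absInertia_map_absGaloisRestrict_le` only uses the section variables that occur in its
body, so — exactly as for its companion `IsFrobPow.absGaloisRestrict` (discharged in
`LocalGaloisGroupProofs.lean`) — the registered fact quantifies over an *arbitrary* `[Algebra F E]`
between two non-archimedean local fields: neither `[FiniteDimensional F E]` nor
`[ValuativeExtension F E]` is among its arguments.  It is nevertheless true in this generality,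
and it is proved here as registered, because a ring homomorphism of non-archimedean local fields is
automatically an embedding of valued fields (`cast_residueFieldCard_eq_zero_of_algebra` feeding the
sibling file's `valuativeExtension_of_cast_residueFieldCard_eq_zero`; unconditional).

## Architecture of the proof (everything below is proved; no fact is assumed)

1. *`p`-power towers of principal units* (`K` a non-archimedean local field, `ℓ = char 𝓀[K]`, so
   `ℓ ∈ 𝓂[K]`): `y ≡ 1 (mod 𝓂^j)`, `j ≥ 1` implies `y ^ ℓ ≡ 1 (mod 𝓂^(j+1))`
   (`pow_ringChar_sub_one_mem_pow_succ`, via `y ^ ℓ - 1 = (y - 1)·(1 + y + ⋯ + y^(ℓ-1))` and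
   `1 + y + ⋯ + y^(ℓ-1) ≡ ℓ ≡ 0`), hence a principal unit which is an `ℓ^k`-th power of a principal
   unit for every `k` lies in `⋂ₖ (1 + 𝓂^k) = {1}` (Krull; `eq_one_of_forall_exists_pow_ringChar_pow_eq`).
   This is Serre, *Local Fields*, Ch. II §4, Lemma 1 and Prop. 8 (ii).
2. *Homomorphisms preserve the residue characteristic* (`natCast_ringChar_residueField_eq_zero`:
   `char 𝓀[E] = 0` in `𝓀[F]` for any `[Algebra F E]`).  If not, `ℓ = char 𝓀[E]` is a unit of
   `𝒪[F]`, so by Hensel (`exists_pow_eq_of_sub_one_mem_maximalIdeal` of the sibling file) every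
   principal unit `x` of `F` is an `ℓ^k`-th power of a principal unit `z_k` for every `k`; the
   images `φ z_k` are units of `𝒪[E]` (`valuation_algebraMap_eq_one_of_sub_one_mem`, sibling file),
   so `(φ x) ^ (q_E - 1)` is a principal unit of `E` which is an `ℓ^k`-th power of the principal unit
   `(φ z_k) ^ (q_E - 1)` for every `k`, whence `(φ x) ^ (q_E - 1) = 1` by step 1 and
   `x ^ (q_E - 1) = 1`.  But the principal units `1 + π ^ (n+1)`, `n ∈ ℕ`, are pairwise distinct,
   while `X ^ (q_E - 1) = 1` has at most `q_E - 1` roots in `F` — contradiction.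
3. Hence `q_E = 0` in `𝓀[F]` (`cast_residueFieldCard_eq_zero_of_algebra`), which is the hypothesis
   of the automatic-continuity theorem
   `IsNonarchimedeanLocalField.valuativeExtension_of_cast_residueFieldCard_eq_zero` of
   `LocalGaloisGroupProofs.lean`; so `ValuativeExtension F E` holds unconditionally
   (`valuativeExtension_of_cast_residueFieldCard_eq_zero cast_residueFieldCard_eq_zero_of_algebra`).
4. *Assembly* (`absInertia_map_absGaloisRestrict_le_holds`): with `ι = absClosureEmbedding F E`,
   `σ ∈ I_E` and `y ∈ S_F`, put `z = res σ • y - y`; then `ι z = σ • ι y - ι y ∈ 𝔓_E`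
   (`absGaloisRestrict_apply_smul`, `ι y ∈ S_E` by `absClosureEmbedding_mem_absIntegers_iff`), and
   `𝔓_F = ι⁻¹(𝔓_E) ∩ S_F` (`absClosureEmbedding_mem_absMaximalIdeal_iff`, sibling file: uniqueness
   of the extension of the absolute value of the complete field `F`, via Mathlib's
   `spectralNorm_unique`), so `z ∈ 𝔓_F`.

Mathlib search: Mathlib has `IsNonarchimedeanLocalField` (with `IsDiscreteValuationRing 𝒪[K]`,
`Finite 𝓀[K]`), `ValuativeExtension`, `Ideal.iInf_pow_eq_bot_of_isLocalRing` (Krull),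
`Polynomial.nthRootsFinset`, `mul_geom_sum`, but no statement that homomorphisms of local fields
preserve the residue characteristic or are continuous, and no inertia groups of local fields
(grep `ValuativeExtension`, `ringChar`, `inertia` in `Mathlib/NumberTheory/LocalField`,
`Mathlib/RingTheory/Valuation`); nothing here duplicates a Mathlib or `Literature` declaration
(the conditional automatic-continuity results of `LocalGaloisGroupProofs.lean` are reused, not
restated).

## References

* J.-P. Serre, *Local Fields*, GTM 67 (1979), Ch. I §7, Prop. 22 a) (`T(L/E) = T(L/K) ∩ G(L/E)`),
  Ch. II §4, Lemma 1 and Prop. 8 (`p`-th powers and the filtration; an element that is a `p^n`-th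
  power for all `n`).  Key `SerreLocalFields1979`.
* J. Tate, *Number theoretic background*, Proc. Sympos. Pure Math. XXXIII Part 2 (Corvallis 1977),
  AMS 1979, §1.4, (1.4.5)–(1.4.6) (`W_E = G_E ∩ W_F`, `I_E = G_E ∩ I_F`).  Keys `Corvallis1979`,
  `TateNTB1979`.
* J. W. S. Cassels, *Global fields*, Ch. II of Cassels–Fröhlich (1967), §10 (uniqueness of the
  extension of a complete valuation; equivalent valuations).  Key `CasselsFrohlichANT1967`.

Design notes.
* No definition, instance, notation or attribute is introduced; the unconditional
  `ValuativeExtension F E` is obtained inside the proof through `haveI`, not declared as an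
  instance, so that no global instance between two unrelated `ValuativeRel` structures is created.
* The file imports `LocalGaloisGroupProofs.lean` (Hensel for `X ^ n - u`, conditional automatic
  continuity, `ι⁻¹(𝔓_E) = 𝔓_F`) and `Mathlib.RingTheory.Filtration` (Krull's intersection theorem).
-/

noncomputable section

open scoped Pointwise
open ValuativeRel Field

namespace Literature.NumberTheory.GaloisRepresentations

namespace IsNonarchimedeanLocalField

/-! ### `p`-power towers of principal units -/

section PrincipalUnits

variable {K : Type*} [Field K] [ValuativeRel K] [TopologicalSpace K] [IsNonarchimedeanLocalField K]

/-- Let `ℓ = char 𝓀[K]` be the residue characteristic of the non-archimedean local field `K`.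
If `y ≡ 1 (mod 𝓂[K] ^ j)` with `j ≥ 1`, then `y ^ ℓ ≡ 1 (mod 𝓂[K] ^ (j + 1))`:
`y ^ ℓ - 1 = (y - 1) (1 + y + ⋯ + y ^ (ℓ - 1))` and the second factor is `≡ ℓ ≡ 0 (mod 𝓂[K])`.
Ref: Serre, *Local Fields*, Ch. II §4, Lemma 1 (`a ≡ b mod 𝔞ₙ ⇒ a^p ≡ b^p mod 𝔞ₙ₊₁`, as
`p ∈ 𝔞₁`). [cite: SerreLocalFields1979, Ch. II §4 Lemma 1] -/
theorem pow_ringChar_sub_one_mem_pow_succ {y : 𝒪[K]} {j : ℕ} (hj : j ≠ 0)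
    (hy : y - 1 ∈ 𝓂[K] ^ j) : y ^ ringChar 𝓀[K] - 1 ∈ 𝓂[K] ^ (j + 1) := by
  have hy1 : y - 1 ∈ 𝓂[K] := Ideal.pow_le_self hj hy
  have hsum : (∑ i ∈ Finset.range (ringChar 𝓀[K]), y ^ i) ∈ 𝓂[K] := by
    rw [← IsLocalRing.residue_eq_zero_iff, map_sum]
    have hres : IsLocalRing.residue 𝒪[K] y = 1 := by
      rw [← sub_eq_zero, ← map_one (IsLocalRing.residue 𝒪[K]), ← map_sub,
        IsLocalRing.residue_eq_zero_iff]
      exact hy1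
    simp only [map_pow, hres, one_pow, Finset.sum_const, Finset.card_range, nsmul_eq_mul, mul_one]
    exact ringChar.Nat.cast_ringChar
  rw [← mul_geom_sum, pow_succ]
  exact Ideal.mul_mem_mul hy hsum

/-- Iteration of `pow_ringChar_sub_one_mem_pow_succ`: if `y ≡ 1 (mod 𝓂[K])` then
`y ^ (ℓ ^ k) ≡ 1 (mod 𝓂[K] ^ (k + 1))` for every `k`, `ℓ = char 𝓀[K]`.
Ref: Serre, *Local Fields*, Ch. II §4, Lemma 1 and the induction in the proof of Prop. 8.
[cite: SerreLocalFields1979, Ch. II §4 Lemma 1] -/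
theorem pow_ringChar_pow_sub_one_mem_pow {y : 𝒪[K]} (hy : y - 1 ∈ 𝓂[K]) (k : ℕ) :
    y ^ ringChar 𝓀[K] ^ k - 1 ∈ 𝓂[K] ^ (k + 1) := by
  induction k with
  | zero => simpa using hy
  | succ k ih =>
    rw [pow_succ (ringChar 𝓀[K]) k, pow_mul]
    exact pow_ringChar_sub_one_mem_pow_succ k.succ_ne_zero ih

/-- A principal unit `u ≡ 1 (mod 𝓂[K])` of a non-archimedean local field which, for every `k`, is
the `ℓ ^ k`-th power of some principal unit (`ℓ = char 𝓀[K]`) equals `1`: by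
`pow_ringChar_pow_sub_one_mem_pow`, `u - 1 ∈ ⋂ₖ 𝓂[K] ^ k = 0` (Krull's intersection theorem in
the noetherian local ring `𝒪[K]`).  This is the case `λ = 1` of Serre's characterisation of the
multiplicative representatives as the elements that are `p ^ n`-th powers for all `n`.
Ref: Serre, *Local Fields*, Ch. II §4, Prop. 8 (ii). [cite: SerreLocalFields1979, Ch. II §4 Prop. 8 (ii)] -/
theorem eq_one_of_forall_exists_pow_ringChar_pow_eq {u : 𝒪[K]}
    (h : ∀ k : ℕ, ∃ y : 𝒪[K], y - 1 ∈ 𝓂[K] ∧ y ^ ringChar 𝓀[K] ^ k = u) : u = 1 := by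
  have hmem : ∀ k, u - 1 ∈ 𝓂[K] ^ k := fun k => by
    obtain ⟨y, hy, rfl⟩ := h k
    exact Ideal.pow_le_pow_right k.le_succ (pow_ringChar_pow_sub_one_mem_pow hy k)
  have hu : u - 1 ∈ (⨅ k : ℕ, 𝓂[K] ^ k : Ideal 𝒪[K]) := Ideal.mem_iInf.mpr hmem
  rw [Ideal.iInf_pow_eq_bot_of_isLocalRing _ (IsLocalRing.maximalIdeal.isMaximal 𝒪[K]).ne_top,
    Ideal.mem_bot] at hu
  exact sub_eq_zero.mp hu

end PrincipalUnits

/-! ### Homomorphisms of local fields preserve the residue characteristic -/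

section ResidueChar

variable {F E : Type*} [Field F] [ValuativeRel F] [TopologicalSpace F]
  [IsNonarchimedeanLocalField F] [Field E] [ValuativeRel E] [TopologicalSpace E]
  [IsNonarchimedeanLocalField E] [Algebra F E]

/-- Let `φ : F → E` be a ring homomorphism of non-archimedean local fields (an `Algebra F E`) and
suppose that the residue characteristic `ℓ = char 𝓀[E]` of `E` were a unit in `𝒪[F]`.  Then every
principal unit `x` of `F` (`v_F(x - 1) < 1`) satisfies `x ^ (q_E - 1) = 1`: for each `k`, Hensel's
lemma in `F` writes `x = z_k ^ (ℓ ^ k)` with `z_k` a principal unit; `φ z_k` is a unit of `𝒪[E]`,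
so `(φ x) ^ (q_E - 1)` is a principal unit of `E` that is an `ℓ ^ k`-th power of the principal
unit `(φ z_k) ^ (q_E - 1)` for every `k`, hence equals `1`
(`eq_one_of_forall_exists_pow_ringChar_pow_eq`), and `φ` is injective.  (Auxiliary step of
`natCast_ringChar_residueField_eq_zero`, where this is shown to be absurd.)
Ref: Serre, *Local Fields*, Ch. II §4, Prop. 7 (Hensel) and Prop. 8 (ii); Cassels–Fröhlich,
Ch. II §10. [folklore] -/
theorem pow_residueFieldCard_sub_one_eq_one_of_valuation_sub_one_lt_one
    (hℓ : (ringChar 𝓀[E] : 𝓀[F]) ≠ 0) {x : F} (hx : valuation F (x - 1) < 1) :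
    x ^ (residueFieldCard E - 1) = 1 := by
  have hx1 : valuation F x = 1 := by
    have h := (valuation F).map_one_add_of_lt hx
    rwa [add_sub_cancel] at h
  set u : 𝒪[F] := ⟨x, hx1.le⟩ with hu_def
  have hu : u - 1 ∈ 𝓂[F] := (mem_maximalIdeal_iff_valuation_lt_one _).mpr hx
  have hvx : valuation E (algebraMap F E x) = 1 := valuation_algebraMap_eq_one_of_sub_one_mem hu
  set w : 𝒪[E] := ⟨algebraMap F E x, hvx.le⟩ with hw_def
  have hw1 : w ^ (residueFieldCard E - 1) = 1 := by
    apply eq_one_of_forall_exists_pow_ringChar_pow_eq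
    intro k
    have hn : ((ringChar 𝓀[E] ^ k : ℕ) : 𝓀[F]) ≠ 0 := by
      rw [Nat.cast_pow]
      exact pow_ne_zero _ hℓ
    obtain ⟨z, hz, hz1⟩ := exists_pow_eq_of_sub_one_mem_maximalIdeal hn hu
    have hvz : valuation E (algebraMap F E z) = 1 := valuation_algebraMap_eq_one_of_sub_one_mem hz1
    refine ⟨(⟨algebraMap F E z, hvz.le⟩ : 𝒪[E]) ^ (residueFieldCard E - 1),
      pow_residueFieldCard_sub_one_sub_one_mem hvz, ?_⟩
    rw [← pow_mul, mul_comm, pow_mul]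
    congr 1
    apply Subtype.ext
    change algebraMap F E z ^ (ringChar 𝓀[E] ^ k) = algebraMap F E x
    rw [← map_pow, ← SubmonoidClass.coe_pow, hz]
  have h := congrArg (fun v : 𝒪[E] => (v : E)) hw1
  change algebraMap F E x ^ (residueFieldCard E - 1) = 1 at h
  rwa [← map_pow, map_eq_one_iff _ (algebraMap F E).injective] at h

/-- **Homomorphisms of non-archimedean local fields preserve the residue characteristic**: for
any ring homomorphism `F → E` of non-archimedean local fields (an `Algebra F E`),
`char 𝓀[E] = 0` in `𝓀[F]`, i.e. `char 𝓀[F] = char 𝓀[E]`.  Otherwise, by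
`pow_residueFieldCard_sub_one_eq_one_of_valuation_sub_one_lt_one`, every principal unit of `F`
would be a root of `X ^ (q_E - 1) - 1`, which has at most `q_E - 1` roots, whereas the principal
units `1 + π ^ (n + 1)` (`0 < v(π) < 1`, `n ∈ ℕ`) are pairwise distinct.
Ref: the standard argument that homomorphisms of local fields are continuous; Serre, *Local
Fields*, Ch. II §4, Prop. 8 (ii); Cassels–Fröhlich, Ch. II §10. [folklore] -/
theorem natCast_ringChar_residueField_eq_zero : (ringChar 𝓀[E] : 𝓀[F]) = 0 := by
  by_contra hℓ
  -- an element of valuation strictly between `0` and `1`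
  obtain ⟨π, hπ0, hπ1⟩ : ∃ π : F, 0 < valuation F π ∧ valuation F π < 1 := by
    obtain ⟨γ, hγ0, hγ1⟩ := ValuativeRel.IsNontrivial.exists_lt_one (R := F)
    obtain ⟨π, rfl⟩ := valuation_surjective γ
    exact ⟨π, hγ0, hγ1⟩
  -- infinitely many principal units `1 + π ^ (n + 1)` …
  have hinj : Function.Injective fun n : ℕ => 1 + π ^ (n + 1) := by
    intro m n hmn
    have h := congrArg (valuation F) (add_left_cancel hmn)
    rw [map_pow, map_pow] at h
    have := (pow_right_strictAnti₀ hπ0 hπ1).injective h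
    omega
  -- … all of which are roots of `X ^ (q_E - 1) - 1`
  have hN : 0 < residueFieldCard E - 1 := Nat.sub_pos_of_lt (one_lt_residueFieldCard E)
  have hroots : ∀ n : ℕ, (1 + π ^ (n + 1)) ^ (residueFieldCard E - 1) = 1 := fun n =>
    pow_residueFieldCard_sub_one_eq_one_of_valuation_sub_one_lt_one hℓ
      (by rw [add_sub_cancel_left, map_pow]; exact pow_lt_one₀ zero_le hπ1 n.succ_ne_zero)
  have hfin : (Set.range fun n : ℕ => 1 + π ^ (n + 1)).Finite := by
    refine (Polynomial.nthRootsFinset (residueFieldCard E - 1) (1 : F)).finite_toSet.subset ?_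
    rintro _ ⟨n, rfl⟩
    exact (Polynomial.mem_nthRootsFinset hN (1 : F)).mpr (hroots n)
  exact Set.infinite_range_of_injective hinj hfin

/-- For any ring homomorphism `F → E` of non-archimedean local fields, the residue cardinality
`q_E = char 𝓀[E] ^ f` (`f ≥ 1`) vanishes in `𝓀[F]`.  This is exactly the hypothesis of the
conditional automatic-continuity theorem
`Literature.NumberTheory.GaloisRepresentations.IsNonarchimedeanLocalField.valuativeExtension_of_cast_residueFieldCard_eq_zero`,
so **automatic continuity holds unconditionally**: every `F`-algebra structure on `E` is a
valuative extension,
`valuativeExtension_of_cast_residueFieldCard_eq_zero cast_residueFieldCard_eq_zero_of_algebra :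
ValuativeExtension F E` (used through `haveI` below; deliberately not an instance).
Ref: Serre, *Local Fields*, Ch. II §1 (finite residue fields) and §4; Cassels–Fröhlich, Ch. II §10
(uniqueness of complete valuations up to equivalence). [folklore] -/
theorem cast_residueFieldCard_eq_zero_of_algebra : (residueFieldCard E : 𝓀[F]) = 0 := by
  obtain ⟨f, hf0, hf⟩ := residueFieldCard_eq_pow_ringChar E
  rw [hf, Nat.cast_pow, natCast_ringChar_residueField_eq_zero, zero_pow hf0.ne']

end ResidueChar

end IsNonarchimedeanLocalField

open GaloisRepresentations.IsNonarchimedeanLocalField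

/-! ### Discharge of `Literature.NumberTheory.GaloisRepresentations.absInertia_map_absGaloisRestrict_le` -/

section Holds

variable (F E : Type*) [Field F] [ValuativeRel F] [TopologicalSpace F]
  [IsNonarchimedeanLocalField F] [Field E] [ValuativeRel E] [TopologicalSpace E]
  [IsNonarchimedeanLocalField E] [Algebra F E]

/-- **Discharge of `Literature.NumberTheory.GaloisRepresentations.absInertia_map_absGaloisRestrict_le`.**
For non-archimedean local fields `F`, `E` and an `F`-algebra structure on `E` (automatically a
valuative extension, `cast_residueFieldCard_eq_zero_of_algebra`), the restriction
`res = absGaloisRestrict F E : Gal(Ē/E) → Gal(F̄/F)` maps the inertia group `I_E` into `I_F`: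
`res (I_E) ≤ I_F` (indeed `I_E = res⁻¹ (I_F)`; Serre: `T(L/E) = T(L/K) ∩ G(L/E)`, Tate:
`W_E = G_E ∩ W_F`).  Proof: for `σ ∈ I_E` and `y ∈ S_F` put `z = res σ • y - y`; with
`ι = absClosureEmbedding F E` one has `ι z = σ • ι y - ι y ∈ 𝔓_E` (`absGaloisRestrict_apply_smul`,
`ι y ∈ S_E`), and `𝔓_F = ι⁻¹(𝔓_E) ∩ S_F` (`absClosureEmbedding_mem_absMaximalIdeal_iff`), so
`z ∈ 𝔓_F`.
Ref: Serre, *Local Fields*, Ch. I §7, Prop. 22 a); Tate, *Number theoretic background*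
(Corvallis 1979), §1.4, (1.4.5)–(1.4.6). [cite: SerreLocalFields1979, Ch. I §7 Prop. 22 a)]
[cite: Corvallis1979, §1.4 (1.4.5)–(1.4.6)] -/
theorem absInertia_map_absGaloisRestrict_le_holds : absInertia_map_absGaloisRestrict_le F E := by
  haveI : ValuativeExtension F E :=
    valuativeExtension_of_cast_residueFieldCard_eq_zero cast_residueFieldCard_eq_zero_of_algebra
  intro τ hτ
  obtain ⟨σ, hσ, rfl⟩ := Subgroup.mem_map.mp hτ
  rw [mem_absInertia_iff] at hσ
  rw [mem_absInertia_iff]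
  intro y
  set ι := absClosureEmbedding F E with hι
  have hy : ι y ∈ absIntegers 𝒪[E] E := (absClosureEmbedding_mem_absIntegers_iff _).mpr y.2
  set z : absIntegers 𝒪[F] F := (absGaloisRestrict F E).toMonoidHom σ • y - y with hz_def
  have hz : ι z ∈ absIntegers 𝒪[E] E := (absClosureEmbedding_mem_absIntegers_iff _).mpr z.2
  rw [← absClosureEmbedding_mem_absMaximalIdeal_iff z hz]
  convert hσ ⟨ι y, hy⟩ using 1
  apply Subtype.ext
  change ι (((absGaloisRestrict F E σ • y : absIntegers 𝒪[F] F) : AlgebraicClosure F) - y) =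
    ((σ • (⟨ι y, hy⟩ : absIntegers 𝒪[E] E) : absIntegers 𝒪[E] E) : AlgebraicClosure E) - ι y
  rw [map_sub, integralClosure.coe_smul, integralClosure.coe_smul, absGaloisRestrict_apply_smul]

end Holds

end Literature.NumberTheory.GaloisRepresentations
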